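import Mathlib
import HarnessLib
import Summits.PneNP.PneNP.Theorems.AeaCutRectanglesTransversalEngine
import Summits.PneNP.PneNP.Theorems.AeaCutRectanglesFixedCutFooling
import Summits.PneNP.PneNP.Theorems.AeaCutRectanglesDutyRectangles

/-!
# Crux FoolingMeasure (stmt-PneNP-19727) — p4 g10: the ROBUST transversal engine (`D2ᵣ`, Hamming-ball loss)

Companion to `Cruxes/FoolingMeasure/BarrierNotesP4g10.md` §1.  Lens «barrier inversion at crux level»: every
witness wall of the p4 lineage (rank wall g6, criticality/bivalence walls g8–g9, closure avalanche g7) kills unit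
systems with EXACT private witnesses — hypothesis **D2** of the landed engine
`AeaCutRectanglesTransversalEngine.rect_mass_le_half_pow` (`Γ − πᵢ` is 3-colourable for EVERY unit `i`).  This file
types the statement JUST OUTSIDE that class and proves it still concludes the crux BY NAME:

* `RobustD2 W π r`  — `Γ − π_J` is 3-colourable for every set `J` of AT LEAST `r` units (`r = 1` is exactly D2:
  `robustD2_one_iff`; monotone in `r`: `RobustD2.mono`).
* `hybrid_subset_sdiff`, `card_sdiff_insideSet_lt` — the ROBUST HYBRID ARGUMENT: two transversals `t, t'` whose graphs
  lie in one cut rectangle over `B` inside NON-3-COL satisfy `|inside(t) \ inside(t')| < r` (the hybrid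
  `α ∪ β'` avoids every unit of `inside(t) \ inside(t')`).
* `card_rect_transversals_le_ball`, `rect_mass_le_robust` — hence the inside-patterns of the rectangle's transversals on any
  unit set `I` lie in a Hamming ball of radius `2r − 2`, and the `mu`-mass of the rectangle is at most
  `(∑_{j ≤ 2r−2} C(|I|, j)) · (∏_{i ∈ I} max(aᵢ,bᵢ)) · (∏_{i ∉ I} |πᵢ|) / ∏ᵢ |πᵢ|`.
* `rect_mass_le_ball` — for 2-edge units and `I` a set of units SPLIT by `B`: mass `≤ (∑_{j<2r−1} C(|I|,j)) / 2^{|I|}`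
  (`r = 1`: the landed `(1/2)^{|I|}`).
* `foolingMeasure_of_robustSpreadSystem` — the ROBUST SPREAD REDUCTION: a family of 2-edge unit systems with D1,
  `RobustD2 W π r` and, over every near-balanced cut, a split set `I` with
  `∑_{j<2r−1} C(|I|,j) ≤ 2^{|I| − ((n/2)·log₂ n + C·n)}` gives
  `Summit.PneNP.PneNP.Theses.AeaCutRectangles.FoolingMeasure` (same `ε`, same schedule, measure `mu W π`).
* `robustSpread_of_exactSpread`, `foolingMeasure_of_exactSpread` — the landed exact reduction
  (`AeaCutRectanglesFixedCutFooling.foolingMeasure_of_spreadSystem`) is the case `r = 1`.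
* `ball_le_two_rpow`, `foolingMeasure_of_robustSpreadSystem_additive` — the ADDITIVE form of the price: a split set with
  `(n/2)·log₂ n + C·n + (2r − 2)·log₂(|I| + 1) ≤ |I|` suffices (robustness `r` costs `(2r−2)·log₂(|I|+1)` extra split
  units; `r = Θ(n)` is affordable as soon as the design has `K·n·log₂ n` split units, `K > 1`).
* `exists_mono_unit_of_witness`, `exists_fresh_witness` — the ROBUST EXACTNESS PRINCIPLE (a witness for `J` is
  monochromatic on both pairs of SOME unit of `J`) and one step of the robust witness chain (`#units − r + 1` witnesses in
  unitriangular position) — the entry point of the witness walls, now one-sided (memo §3).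
* `choose_le_of_monoLoad` — the MONO-LOAD WALL `C(m,r) ≤ 3^{|V|}·C(m−μ, r−μ)`: if every frame colouring loads `≥ μ`
  units then `(m/r)^μ ≤ 3^{|V|}`; robust designs are near-exact on average, and the dense designs that died at exactness
  stay dead for every affordable `r` (memo §3).
* `Toy.robust_not_exact` — a 10-vertex, 2-unit system with D1 and `RobustD2 · · 2` but NOT D2 (`decide`): the relaxation
  is strict and the hypothesis class non-empty.

So exactness of the private witnesses is NOT load-bearing for X1: a design may let every `r − 1` units fail to have
witnesses avoiding them jointly, at the price of the binary-entropy factor `2^{H(2(r−1)/|I|)·|I|}` (sharp: radius `r − 1`,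
Kleitman's diameter theorem, memo §2).  Of the lineage's walls, the unit floor (g5) and — additively, `m ≤ 4n + r − 3` via
short 2-SAT cores — the typed/bivalent wall (g9) survive robustness on paper; the rank wall (g6) and the general
bivalence wall use TWO-SIDED privacy (`exists_source`) and are open for `r ≥ 2` (memo §3).

HONEST FRAMING: elementary finite combinatorics about the HYPOTHESIS side of a restricted-model crux (Fagin's
complement ladder, NON-3-COL vs ESO(∃*∀∃∀)); FRONTIER material; nothing here bears on P vs NP.

Sources: the landed engine files (archive AEA.md Thm. 4.2); D. J. Kleitman, "On a combinatorial conjecture of Erdős",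
J. Combin. Theory 1 (1966) 209–214 (diameter theorem — the sharp ball, memo §2); the p4 memos BarrierNotesP4g5–g9.
-/

set_option linter.dupNamespace false

namespace Summit.PneNP.PneNP.Cruxes.FoolingMeasure.P4g10

open Finset
open Summit.PneNP.PneNP.Theorems.AeaCutRectanglesTransversalEngine
open Summit.PneNP.PneNP.Theorems.AeaCutRectanglesFixedCutFooling
open Summit.PneNP.PneNP.Theorems.AeaCutRectanglesDutyRectangles

/-! ### `Γ − π_J` and robust D2 -/

/-- `Γ − π_J`: the frame and every unit outside `J`. -/
def gammaMinusSet {V ι : Type*} [DecidableEq V] [Fintype ι] [DecidableEq ι] (W : Finset (Sym2 V))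
    (π : ι → Finset (Sym2 V)) (J : Finset ι) : Finset (Sym2 V) :=
  W ∪ (univ.filter fun j => j ∉ J).biUnion π

/-- Membership in `Γ − π_J`. -/
theorem mem_gammaMinusSet {V ι : Type*} [DecidableEq V] [Fintype ι] [DecidableEq ι] {W : Finset (Sym2 V)}
    {π : ι → Finset (Sym2 V)} {J : Finset ι} {e : Sym2 V} :
    e ∈ gammaMinusSet W π J ↔ e ∈ W ∨ ∃ j, j ∉ J ∧ e ∈ π j := by
  simp [gammaMinusSet]

/-- `Γ − π_{{i}} = Γ − πᵢ`. -/
theorem gammaMinusSet_singleton {V ι : Type*} [DecidableEq V] [Fintype ι] [DecidableEq ι] (W : Finset (Sym2 V))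
    (π : ι → Finset (Sym2 V)) (i : ι) : gammaMinusSet W π {i} = gammaMinus W π i := by
  ext e
  simp [mem_gammaMinusSet, mem_gammaMinus]

/-- `Γ − π_J` shrinks as `J` grows. -/
theorem gammaMinusSet_anti {V ι : Type*} [DecidableEq V] [Fintype ι] [DecidableEq ι] {W : Finset (Sym2 V)}
    {π : ι → Finset (Sym2 V)} {J J' : Finset ι} (h : J ⊆ J') : gammaMinusSet W π J' ⊆ gammaMinusSet W π J := by
  intro e he
  rw [mem_gammaMinusSet] at he ⊢
  rcases he with hw | ⟨j, hj, hej⟩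
  · exact Or.inl hw
  · exact Or.inr ⟨j, fun hjJ => hj (h hjJ), hej⟩

/-- **`r`-ROBUST D2**: removing ANY `≥ r` units (keeping the frame) leaves a 3-colourable graph.  `r = 1` is the
exactness hypothesis D2 of the landed engine; larger `r` is WEAKER. -/
def RobustD2 {V ι : Type*} [DecidableEq V] [Fintype ι] [DecidableEq ι] (W : Finset (Sym2 V))
    (π : ι → Finset (Sym2 V)) (r : ℕ) : Prop :=
  ∀ J : Finset ι, r ≤ J.card → (SimpleGraph.fromEdgeSet (↑(gammaMinusSet W π J) : Set (Sym2 V))).Colorable 3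

/-- Robustness is monotone: `D2ᵣ ⇒ D2ᵣ'` for `r ≤ r'`. -/
theorem RobustD2.mono {V ι : Type*} [DecidableEq V] [Fintype ι] [DecidableEq ι] {W : Finset (Sym2 V)}
    {π : ι → Finset (Sym2 V)} {r r' : ℕ} (hrr' : r ≤ r') (h : RobustD2 W π r) : RobustD2 W π r' :=
  fun J hJ => h J (hrr'.trans hJ)

/-- `D2₁` is exactly D2. -/
theorem robustD2_one_iff {V ι : Type*} [DecidableEq V] [Fintype ι] [DecidableEq ι] {W : Finset (Sym2 V)}
    {π : ι → Finset (Sym2 V)} :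
    RobustD2 W π 1 ↔ ∀ i, (SimpleGraph.fromEdgeSet (↑(gammaMinus W π i) : Set (Sym2 V))).Colorable 3 := by
  constructor
  · intro h i
    have h1 := h {i} (by simp)
    rwa [gammaMinusSet_singleton] at h1
  · intro h J hJ
    obtain ⟨i, hi⟩ := Finset.card_pos.1 (Nat.lt_of_lt_of_le Nat.zero_lt_one hJ)
    have hsub : gammaMinusSet W π J ⊆ gammaMinus W π i := by
      rw [← gammaMinusSet_singleton]
      exact gammaMinusSet_anti (singleton_subset_iff.2 hi)
    exact (h i).mono_left (SimpleGraph.fromEdgeSet_mono (Finset.coe_subset.2 hsub))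

/-! ### The robust exactness principle (entry point of the witness walls) -/

/-- **ROBUST EXACTNESS PRINCIPLE.**  Under D1 (non-empty units), every proper 3-colouring of `Γ − π_J` is monochromatic
on EVERY pair of SOME unit `j ∈ J` (else choosing a bichromatic pair in each unit of `J` gives a properly coloured
transversal graph).  `J = {i}` is the exactness principle of the exact theory (a D2 witness of unit `i` is monochromatic
on both pairs of `i`, BarrierNotesP4g6 (e)); for `|J| = r ≥ 2` the witness is PRIVATE FOR ONE UNIT OF `J` ONLY MODULO `J`:
bichromatic on every unit outside `J`, unconstrained on `J ∖ {j}`. -/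
theorem exists_mono_unit_of_witness {V ι : Type*} [Fintype V] [DecidableEq V] [Fintype ι] [DecidableEq ι]
    {W : Finset (Sym2 V)} {π : ι → Finset (Sym2 V)} (hne : ∀ i, (π i).Nonempty)
    (hD1 : ∀ t : ι → Sym2 V, (∀ i, t i ∈ π i) →
      ¬ (SimpleGraph.fromEdgeSet (↑(tg W t) : Set (Sym2 V))).Colorable 3)
    {J : Finset ι} {c : V → Fin 3} (hc : c ∉ killSet (gammaMinusSet W π J)) :
    ∃ j ∈ J, ∀ e ∈ π j, (e.map c).IsDiag := by
  by_contra hcon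
  have hcon' : ∀ j ∈ J, ∃ e ∈ π j, ¬ (e.map c).IsDiag := by
    intro j hj
    by_contra h'
    exact hcon ⟨j, hj, fun e he => by_contra fun hm => h' ⟨e, he, hm⟩⟩
  choose f hf using hcon'
  classical
  let t : ι → Sym2 V := fun j => if h : j ∈ J then f j h else (hne j).choose
  have ht : ∀ i, t i ∈ π i := by
    intro i
    by_cases hi : i ∈ J
    · simp only [t, dif_pos hi]
      exact (hf i hi).1
    · simp only [t, dif_neg hi]
      exact (hne i).choose_spec
  refine hD1 t ht ((colorable_iff_exists_not_mem_killSet _).2 ⟨c, ?_⟩)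
  rintro ⟨e, he, hd, hm⟩
  rcases mem_tg.1 he with hw | ⟨j, rfl⟩
  · exact hc ⟨e, mem_gammaMinusSet.2 (Or.inl hw), hd, hm⟩
  · by_cases hj : j ∈ J
    · have h1 : t j = f j hj := by simp only [t, dif_pos hj]
      rw [h1] at hm
      exact (hf j hj).2 hm
    · exact hc ⟨t j, mem_gammaMinusSet.2 (Or.inr ⟨j, hj, ht j⟩), hd, hm⟩

/-- **ONE STEP OF THE ROBUST WITNESS CHAIN.**  Under D1 and `D2ᵣ`, for every set `U` of "used" units with
`|U| + r ≤ #units` there are a FRESH unit `j ∉ U` and a colouring proper on the frame and on every (loopless) pair of every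
used unit, monochromatic on every pair of `j`.  Iterating from `U = ∅` gives `#units − r + 1` witnesses in UNITRIANGULAR
position (each bichromatic on all EARLIER units) — the pattern rank/parity walls consume; at `r = 1` these are the private
witnesses of the exact theory, which are bichromatic on ALL other units (two-sided), and two-sidedness is exactly what the
majority-source step of the bivalence wall (P4g9 `exists_source`) uses (memo §3). -/
theorem exists_fresh_witness {V ι : Type*} [Fintype V] [DecidableEq V] [Fintype ι] [DecidableEq ι]
    {W : Finset (Sym2 V)} {π : ι → Finset (Sym2 V)} {r : ℕ} (hne : ∀ i, (π i).Nonempty)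
    (hD1 : ∀ t : ι → Sym2 V, (∀ i, t i ∈ π i) →
      ¬ (SimpleGraph.fromEdgeSet (↑(tg W t) : Set (Sym2 V))).Colorable 3)
    {Φ : Set (V → Fin 3)} (hwit : ∀ J : Finset ι, r ≤ J.card → ∃ c ∈ Φ, c ∉ killSet (gammaMinusSet W π J))
    (U : Finset ι) (hU : U.card + r ≤ Fintype.card ι) :
    ∃ j, j ∉ U ∧ ∃ c ∈ Φ, c ∉ killSet W ∧ (∀ e ∈ π j, (e.map c).IsDiag) ∧
      ∀ l ∈ U, ∀ e ∈ π l, ¬ e.IsDiag → ¬ (e.map c).IsDiag := by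
  have hJ : r ≤ (univ \ U).card := by
    rw [card_univ_sdiff]
    omega
  obtain ⟨c, hcΦ, hc⟩ := hwit _ hJ
  obtain ⟨j, hj, hmono⟩ := exists_mono_unit_of_witness hne hD1 hc
  refine ⟨j, (mem_sdiff.1 hj).2, c, hcΦ,
    fun hW => hc (killSet_mono (fun e he => mem_gammaMinusSet.2 (Or.inl he)) hW),
    hmono, fun l hl e he hd hm => hc ⟨e, ?_, hd, hm⟩⟩
  exact mem_gammaMinusSet.2 (Or.inr ⟨l, fun h => (mem_sdiff.1 h).2 hl, he⟩)

/-- `D2ᵣ` is the witness oracle with the class of ALL colourings. -/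
theorem witnesses_of_robustD2 {V ι : Type*} [DecidableEq V] [Fintype ι] [DecidableEq ι]
    {W : Finset (Sym2 V)} {π : ι → Finset (Sym2 V)} {r : ℕ} (hD2r : RobustD2 W π r) :
    ∀ J : Finset ι, r ≤ J.card → ∃ c ∈ (Set.univ : Set (V → Fin 3)), c ∉ killSet (gammaMinusSet W π J) := by
  intro J hJ
  obtain ⟨c, hc⟩ := (colorable_iff_exists_not_mem_killSet _).1 (hD2r J hJ)
  exact ⟨c, Set.mem_univ _, hc⟩

/-- **THE ROBUST WITNESS CHAIN** (newest first).  Under D1 and a witness oracle for all unit sets of size `≥ r` inside a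
class `Φ`, for every `k ≤ #units + 1 − r` there are `k` distinct units `js 0, …, js (k−1)` and witnesses `cs a ∈ Φ`,
proper on the frame, with `cs a` monochromatic on every pair of `js a` and bichromatic on every loopless pair of `js b`
for all `b > a` (UNITRIANGULAR pattern; two-sided privacy is the exact case `r = 1` read in both orders). -/
theorem exists_witnessChain {V ι : Type*} [Fintype V] [DecidableEq V] [Fintype ι] [DecidableEq ι]
    {W : Finset (Sym2 V)} {π : ι → Finset (Sym2 V)} {r : ℕ} (hne : ∀ i, (π i).Nonempty)
    (hD1 : ∀ t : ι → Sym2 V, (∀ i, t i ∈ π i) →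
      ¬ (SimpleGraph.fromEdgeSet (↑(tg W t) : Set (Sym2 V))).Colorable 3)
    {Φ : Set (V → Fin 3)} (hwit : ∀ J : Finset ι, r ≤ J.card → ∃ c ∈ Φ, c ∉ killSet (gammaMinusSet W π J)) :
    ∀ k : ℕ, k + r ≤ Fintype.card ι + 1 →
      ∃ (js : Fin k → ι) (cs : Fin k → V → Fin 3), Function.Injective js ∧ (∀ a, cs a ∈ Φ) ∧
        (∀ a, cs a ∉ killSet W) ∧ (∀ a, ∀ e ∈ π (js a), (e.map (cs a)).IsDiag) ∧
        ∀ a b, a < b → ∀ e ∈ π (js b), ¬ e.IsDiag → ¬ (e.map (cs a)).IsDiag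
  | 0, _ => ⟨Fin.elim0, Fin.elim0, fun a => Fin.elim0 a, fun a => Fin.elim0 a, fun a => Fin.elim0 a,
      fun a => Fin.elim0 a, fun a => Fin.elim0 a⟩
  | k + 1, hk => by
    obtain ⟨js, cs, hinj, hΦ, hW, hmono, hbi⟩ := exists_witnessChain hne hD1 hwit k (by omega)
    obtain ⟨j, hjU, c, hcΦ, hcW, hcm, hcb⟩ := exists_fresh_witness hne hD1 hwit (univ.image js)
      (by rw [card_image_of_injective _ hinj, card_univ, Fintype.card_fin]; omega)
    refine ⟨Fin.cons j js, Fin.cons c cs, ?_, ?_, ?_, ?_, ?_⟩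
    · refine Fin.cons_injective_iff.2 ⟨?_, hinj⟩
      rintro ⟨a, ha⟩
      exact hjU (ha ▸ mem_image_of_mem _ (mem_univ a))
    · refine Fin.cases ?_ (fun a => ?_)
      · simpa using hcΦ
      · simpa using hΦ a
    · refine Fin.cases ?_ (fun a => ?_)
      · simpa using hcW
      · simpa using hW a
    · refine Fin.cases ?_ (fun a => ?_)
      · simpa using hcm
      · simpa using hmono a
    · intro a b hab
      induction b using Fin.cases with
      | zero => exact absurd hab (not_lt.2 (Fin.zero_le a))
      | succ b' =>
        induction a using Fin.cases with
        | zero =>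
          simp only [Fin.cons_zero, Fin.cons_succ]
          exact hcb (js b') (mem_image_of_mem _ (mem_univ _))
        | succ a' =>
          simp only [Fin.cons_succ]
          exact hbi a' b' (Fin.succ_lt_succ_iff.1 hab)

/-! ### The robust rank wall (triangular criterion; degree-2 polynomial method over `ZMod 3`) -/

section RankWall

variable {m R : ℕ}

/-- Index set of the monomials `1`, `y_k`, `y_k y_l` in `R` variables (verbatim `P4g6.MonIdx`; Cruxes workfiles are not
importable, so the three definitions and the product computation of `WitnessRankWall.lean` §1 are restated). -/
abbrev MonIdx (R : ℕ) := Option (Fin R ⊕ (Fin R × Fin R))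

theorem card_monIdx (R : ℕ) : Fintype.card (MonIdx R) = R * R + R + 1 := by
  simp only [MonIdx, Fintype.card_option, Fintype.card_sum, Fintype.card_fin, Fintype.card_prod]
  ring

/-- Coefficients of `1 − (a i + ∑ k, d i k · y_k)²` on the monomials (verbatim `P4g6.coeffMat`). -/
def coeffMat (a : Fin m → ZMod 3) (d : Fin m → Fin R → ZMod 3) : Matrix (Fin m) (MonIdx R) (ZMod 3) :=
  fun i x => match x with
    | none => 1 - a i ^ 2
    | some (Sum.inl k) => a i * d i k
    | some (Sum.inr (k, l)) => -(d i k * d i l)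

/-- Values of the monomials at the parameter vectors `y j` (verbatim `P4g6.monMat`). -/
def monMat (y : Fin m → Fin R → ZMod 3) : Matrix (MonIdx R) (Fin m) (ZMod 3) :=
  fun x j => match x with
    | none => 1
    | some (Sum.inl k) => y j k
    | some (Sum.inr (k, l)) => y j k * y j l

theorem coeffMat_mul_monMat (a : Fin m → ZMod 3) (d y : Fin m → Fin R → ZMod 3) (i j : Fin m) :
    (coeffMat a d * monMat y) i j = 1 - (a i + ∑ k, y j k * d i k) ^ 2 := by
  set S := ∑ k, y j k * d i k with hS
  have h3 : (3 : ZMod 3) = 0 := by decide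
  have e1 : ∑ k, a i * d i k * y j k = a i * S := by
    rw [hS, Finset.mul_sum]
    exact Finset.sum_congr rfl fun k _ => by ring
  have e2 : ∑ k, ∑ l, -(d i k * d i l) * (y j k * y j l) = -(S * S) := by
    rw [hS, Finset.sum_mul_sum, ← Finset.sum_neg_distrib]
    refine Finset.sum_congr rfl fun k _ => ?_
    rw [← Finset.sum_neg_distrib]
    exact Finset.sum_congr rfl fun l _ => by ring
  rw [Matrix.mul_apply, Fintype.sum_option, Fintype.sum_sum_type, Fintype.sum_prod_type]
  simp only [coeffMat, monMat]
  rw [e1, e2]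
  linear_combination (a i * S) * h3

/-- **TRIANGULAR CRITERION** (robust form of `P4g6.privateZero_le_rank`).  If `Δ i j := a i + ∑ k, y j k * d i k`
vanishes on the diagonal and is non-zero STRICTLY BELOW it (`j < i`; nothing is asked above), then `m ≤ R² + R + 1`:
the matrix `(1 − Δ(i,j)²)` is upper unitriangular, hence invertible, and factors through the `R² + R + 1` monomials. -/
theorem triangularZero_le_rank (a : Fin m → ZMod 3) (d y : Fin m → Fin R → ZMod 3)
    (hdiag : ∀ i, a i + ∑ k, y i k * d i k = 0)
    (hlow : ∀ i j, j < i → a i + ∑ k, y j k * d i k ≠ 0) : m ≤ R * R + R + 1 := by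
  have hsq : ∀ z : ZMod 3, z ≠ 0 → 1 - z ^ 2 = 0 := by decide
  have htri : (coeffMat a d * monMat y).BlockTriangular id := by
    intro i j hij
    rw [coeffMat_mul_monMat]
    exact hsq _ (hlow i j hij)
  have hdet : (coeffMat a d * monMat y).det = 1 := by
    rw [Matrix.det_of_upperTriangular htri]
    refine Finset.prod_eq_one fun i _ => ?_
    rw [coeffMat_mul_monMat, hdiag i]
    ring
  have hunit : IsUnit (coeffMat a d * monMat y) :=
    (Matrix.isUnit_iff_isUnit_det _).2 (by rw [hdet]; exact isUnit_one)
  have hr := Matrix.rank_mul_le_left (coeffMat a d) (monMat y)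
  rw [Matrix.rank_of_isUnit _ hunit, Fintype.card_fin] at hr
  exact hr.trans ((Matrix.rank_le_card_width _).trans (card_monIdx R).le)

end RankWall

/-- **ROBUST RANK WALL.**  If the robust witnesses (one per unit set of size `≥ r`) can all be drawn from ONE affine
family `c(w) = b(w) + ∑ k, y_k · s_k(w)` of dimension `R` over `ZMod 3` (colours read in `ZMod 3` via `Fin.val`), then `#units + 1 ≤ R² + R + 1 + r`, i.e.
`#units ≤ R² + R + r`: the exact wall `m ≤ R² + R + 1` of P4g6 shifts by EXACTLY `r − 1` (the witness chain is
unitriangular instead of diagonal, and the triangular criterion needs no more).  With `r = O(n)` affordable and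
`m ≥ n log₂ n` forced by the unit floor, low-rank algebraic witness families stay dead: `R ≥ √(n log₂ n) · (1 − o(1))`. -/
theorem card_le_affineRank_add {V ι : Type*} [Fintype V] [DecidableEq V] [Fintype ι] [DecidableEq ι]
    {W : Finset (Sym2 V)} {π : ι → Finset (Sym2 V)} {r : ℕ} (hne : ∀ i, (π i).Nonempty)
    (hloop : ∀ i, ∀ e ∈ π i, ¬ e.IsDiag)
    (hD1 : ∀ t : ι → Sym2 V, (∀ i, t i ∈ π i) →
      ¬ (SimpleGraph.fromEdgeSet (↑(tg W t) : Set (Sym2 V))).Colorable 3)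
    {R : ℕ} (b : V → ZMod 3) (s : Fin R → V → ZMod 3)
    (hwit : ∀ J : Finset ι, r ≤ J.card → ∃ c : V → Fin 3,
      (∃ y : Fin R → ZMod 3, ∀ w, ((c w : ℕ) : ZMod 3) = b w + ∑ k, y k * s k w) ∧
        c ∉ killSet (gammaMinusSet W π J))
    (hr : r ≤ Fintype.card ι + 1) :
    Fintype.card ι + 1 ≤ R * R + R + 1 + r := by
  have fin3_eq : ∀ {x x' : Fin 3}, ((x : ℕ) : ZMod 3) = ((x' : ℕ) : ZMod 3) → x = x' := by
    intro x x' h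
    have h' := congrArg ZMod.val h
    rw [ZMod.val_natCast, ZMod.val_natCast, Nat.mod_eq_of_lt x.isLt, Nat.mod_eq_of_lt x'.isLt] at h'
    exact Fin.ext h'
  set Φ : Set (V → Fin 3) :=
    {c | ∃ y : Fin R → ZMod 3, ∀ w, ((c w : ℕ) : ZMod 3) = b w + ∑ k, y k * s k w} with hΦdef
  have hwit' : ∀ J : Finset ι, r ≤ J.card → ∃ c ∈ Φ, c ∉ killSet (gammaMinusSet W π J) := fun J hJ => by
    obtain ⟨c, hy, hc⟩ := hwit J hJ
    exact ⟨c, hy, hc⟩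
  obtain ⟨js, cs, -, hΦ, -, hmono, hbi⟩ :=
    exists_witnessChain hne hD1 hwit' (Fintype.card ι + 1 - r) (by omega)
  have hpair : ∀ i, ∃ u v : V, u ≠ v ∧ s(u, v) ∈ π i := fun i => by
    obtain ⟨e, he⟩ := hne i
    induction e using Sym2.ind with
    | h u v => exact ⟨u, v, fun h => hloop i _ he (Sym2.mk_isDiag_iff.2 h), he⟩
  choose u v huv hmem using hpair
  have hΦ' : ∀ a, ∃ y : Fin R → ZMod 3, ∀ w, ((cs a w : ℕ) : ZMod 3) = b w + ∑ k, y k * s k w :=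
    fun a => hΦ a
  choose y hy using hΦ'
  have key := triangularZero_le_rank (m := Fintype.card ι + 1 - r) (R := R)
    (fun a => b (u (js a)) - b (v (js a))) (fun a k => s k (u (js a)) - s k (v (js a))) y ?_ ?_
  · omega
  · intro a
    have hm : cs a (u (js a)) = cs a (v (js a)) := (map_mk_isDiag_iff _ _ _).1 (hmono a _ (hmem (js a)))
    have e : ((cs a (u (js a)) : ℕ) : ZMod 3) = ((cs a (v (js a)) : ℕ) : ZMod 3) := by rw [hm]
    rw [hy a (u (js a)), hy a (v (js a))] at e
    have e' := sub_eq_zero.2 e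
    simp only [mul_sub, Finset.sum_sub_distrib]
    linear_combination e'
  · intro a a' ha' h
    have hb := hbi a' a ha' _ (hmem (js a)) (fun hd => huv (js a) (Sym2.mk_isDiag_iff.1 hd))
    apply hb
    rw [map_mk_isDiag_iff]
    have e : (b (u (js a)) + ∑ k, y a' k * s k (u (js a))) - (b (v (js a)) + ∑ k, y a' k * s k (v (js a))) = 0 := by
      simp only [mul_sub, Finset.sum_sub_distrib] at h
      linear_combination h
    have e' : ((cs a' (u (js a)) : ℕ) : ZMod 3) = ((cs a' (v (js a)) : ℕ) : ZMod 3) := by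
      rw [hy a' (u (js a)), hy a' (v (js a))]
      exact sub_eq_zero.1 e
    exact fin3_eq e'

/-! ### The mono-load wall: robust witnesses are few, so frames with heavily loaded colourings die -/

/-- **MONO-LOAD WALL (counting form of robust exactness).**  If EVERY proper 3-colouring of the frame `W` is
monochromatic on a (loopless) pair of at least `μ` units, then `D2ᵣ` forces
`C(m, r) ≤ 3^{|V|} · C(m − μ, m − r)` (`m = #units`; note `C(m − μ, m − r) = C(m − μ, r − μ)`): each `r`-set `J` of units
has a witness `c_J` (proper on `Γ − π_J`), whose loaded units all lie in `J`; a colouring with `≥ μ` loaded units serves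
at most `C(m − μ, r − μ)` sets `J`, and there are at most `3^{|V|}` colourings.  Consequence (memo §3): `(m/r)^μ ≤ 3^{|V|}`,
i.e. a design usable by the robust engine has a frame colouring loading `≤ |V|·log₃(m/r)` units — for every affordable
`r ≤ m/8` fewer than `2|V|` of the `m ≥ |V| log₂ |V|` units: NEAR-EXACTNESS ON AVERAGE is forced, and the dense designs
that died at exactness (BarrierNotesP4g7 §4: `Ω(m)` loaded units in every frame colouring) stay dead for all `r ≤ m(1 − o(1))`. -/
theorem choose_le_of_monoLoad {V ι : Type*} [Fintype V] [DecidableEq V] [Fintype ι] [DecidableEq ι]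
    {W : Finset (Sym2 V)} {π : ι → Finset (Sym2 V)} {r : ℕ} (hD2r : RobustD2 W π r) {μ : ℕ}
    (hμ : ∀ c : V → Fin 3, c ∉ killSet W →
      μ ≤ (univ.filter fun i => ∃ e ∈ π i, ¬ e.IsDiag ∧ (e.map c).IsDiag).card) :
    (Fintype.card ι).choose r ≤ 3 ^ Fintype.card V * (Fintype.card ι - μ).choose (Fintype.card ι - r) := by
  classical
  set S : Finset (Finset ι) := powersetCard r (univ : Finset ι) with hSdef
  have hw : ∀ J ∈ S, ∃ c : V → Fin 3, c ∉ killSet (gammaMinusSet W π J) := fun J hJ =>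
    (colorable_iff_exists_not_mem_killSet _).1 (hD2r J (by rw [(mem_powersetCard.1 hJ).2]))
  choose! cw hcw using hw
  have hS : S.card = (Fintype.card ι).choose r := by
    rw [hSdef, card_powersetCard, card_univ]
  rw [← hS, card_eq_sum_card_fiberwise (f := cw) (s := S) (t := (univ : Finset (V → Fin 3))) fun _ _ => mem_univ _]
  have hbound : ∀ c ∈ (univ : Finset (V → Fin 3)),
      (S.filter fun J => cw J = c).card ≤ (Fintype.card ι - μ).choose (Fintype.card ι - r) := by
    intro c _
    rcases (S.filter fun J => cw J = c).eq_empty_or_nonempty with h0 | ⟨J₀, hJ₀⟩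
    · rw [h0, card_empty]
      exact Nat.zero_le _
    · rw [mem_filter] at hJ₀
      have hcJ₀ : c ∉ killSet (gammaMinusSet W π J₀) := by
        rw [← hJ₀.2]
        exact hcw J₀ hJ₀.1
      have hcW : c ∉ killSet W := fun h =>
        hcJ₀ (killSet_mono (fun e he => mem_gammaMinusSet.2 (Or.inl he)) h)
      set M : Finset ι := univ.filter fun i => ∃ e ∈ π i, ¬ e.IsDiag ∧ (e.map c).IsDiag with hMdef
      have hμM : μ ≤ M.card := hμ c hcW
      -- every `J` of the fibre contains the loaded units `M`
      have hMJ : ∀ J ∈ S.filter (fun J => cw J = c), M ⊆ J := by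
        intro J hJ i hi
        rw [mem_filter] at hJ
        have hcJ : c ∉ killSet (gammaMinusSet W π J) := by
          rw [← hJ.2]
          exact hcw J hJ.1
        rw [hMdef, mem_filter] at hi
        obtain ⟨e, he, hd, hm⟩ := hi.2
        by_contra hiJ
        exact hcJ ⟨e, mem_gammaMinusSet.2 (Or.inr ⟨i, hiJ, he⟩), hd, hm⟩
      -- complementation injects the fibre into the `(m − r)`-subsets of `univ \ M`
      calc (S.filter fun J => cw J = c).card
          ≤ (powersetCard (Fintype.card ι - r) (univ \ M)).card := by
            refine card_le_card_of_injOn (fun J => univ \ J) (fun J hJ => ?_) (fun J hJ J' hJ' hJJ' => ?_)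
            · have hJ' : J ∈ S.filter (fun J => cw J = c) := hJ
              have hJS : J ∈ S := (mem_filter.1 hJ').1
              rw [hSdef, mem_powersetCard] at hJS
              rw [Finset.mem_coe, mem_powersetCard, card_univ_sdiff, hJS.2]
              exact ⟨sdiff_subset_sdiff subset_rfl (hMJ J hJ'), rfl⟩
            · have h := congrArg (fun K : Finset ι => univ \ K) hJJ'
              simpa [Finset.sdiff_sdiff_eq_self (subset_univ _)] using h
        _ = (Fintype.card ι - M.card).choose (Fintype.card ι - r) := by
            rw [card_powersetCard, card_univ_sdiff]
        _ ≤ (Fintype.card ι - μ).choose (Fintype.card ι - r) := Nat.choose_le_choose _ (by omega)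
  calc ∑ c ∈ (univ : Finset (V → Fin 3)), (S.filter fun J => cw J = c).card
      ≤ ∑ c ∈ (univ : Finset (V → Fin 3)), (Fintype.card ι - μ).choose (Fintype.card ι - r) := sum_le_sum hbound
    _ = 3 ^ Fintype.card V * (Fintype.card ι - μ).choose (Fintype.card ι - r) := by
        rw [sum_const, smul_eq_mul, card_univ, Fintype.card_fun, Fintype.card_fin]

/-! ### The robust hybrid argument -/

/-- The units that the transversal `t` chooses INSIDE the cut `B`. -/
def insideSet {V ι : Type*} [Fintype V] [DecidableEq V] [Fintype ι] (B : Finset V) (t : ι → Sym2 V) : Finset ι :=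
  univ.filter fun i => ∀ v ∈ t i, v ∈ B

/-- Membership in `insideSet`. -/
theorem mem_insideSet {V ι : Type*} [Fintype V] [DecidableEq V] [Fintype ι] {B : Finset V} {t : ι → Sym2 V} {i : ι} :
    i ∈ insideSet B t ↔ ∀ v ∈ t i, v ∈ B := by
  simp [insideSet]

/-- ROBUST HYBRID: the hybrid of a non-inside part of `tg W t` with an inside part of `tg W t'` misses every unit
of `inside(t) \ inside(t')` at once. -/
theorem hybrid_subset_sdiff {V ι : Type*} [Fintype V] [DecidableEq V] [Fintype ι] [DecidableEq ι] {W : Finset (Sym2 V)}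
    {π : ι → Finset (Sym2 V)} {B : Finset V} {t t' : ι → Sym2 V}
    (ht : ∀ j, t j ∈ π j) (ht' : ∀ j, t' j ∈ π j) {α β' : Finset (Sym2 V)}
    (hα : α ⊆ tg W t) (hβ' : β' ⊆ tg W t') (hαout : ∀ e ∈ α, ¬ ∀ v ∈ e, v ∈ B)
    (hβ'in : ∀ e ∈ β', ∀ v ∈ e, v ∈ B) :
    α ∪ β' ⊆ gammaMinusSet W π (insideSet B t \ insideSet B t') := by
  intro e he
  rw [mem_gammaMinusSet]
  rcases mem_union.1 he with he | he
  · rcases mem_tg.1 (hα he) with hw | ⟨j, rfl⟩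
    · exact Or.inl hw
    · refine Or.inr ⟨j, ?_, ht j⟩
      simp only [mem_sdiff, mem_insideSet, not_and, not_not]
      exact fun h => (hαout _ he h).elim
  · rcases mem_tg.1 (hβ' he) with hw | ⟨j, rfl⟩
    · exact Or.inl hw
    · refine Or.inr ⟨j, ?_, ht' j⟩
      simp only [mem_sdiff, mem_insideSet, not_and, not_not]
      exact fun _ => hβ'in _ he

/-- Under `D2ᵣ`, two transversals whose graphs lie in one cut rectangle over `B` inside NON-3-COL have
`|inside(t) \ inside(t')| < r`. -/
theorem card_sdiff_insideSet_lt {V ι : Type*} [Fintype V] [DecidableEq V] [Fintype ι] [DecidableEq ι] {W : Finset (Sym2 V)}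
    {π : ι → Finset (Sym2 V)} {r : ℕ} (hD2r : RobustD2 W π r) {B : Finset V}
    {𝓐 𝓑 : Finset (Finset (Sym2 V))}
    (h𝓐 : ∀ α ∈ 𝓐, ∀ e ∈ α, ∃ v ∈ e, v ∉ B) (h𝓑 : ∀ β ∈ 𝓑, ∀ e ∈ β, ∀ v ∈ e, v ∈ B)
    (hN : ∀ α ∈ 𝓐, ∀ β ∈ 𝓑, ¬ (SimpleGraph.fromEdgeSet ((α ∪ β : Finset (Sym2 V)) : Set (Sym2 V))).Colorable 3)
    {α β α' β' : Finset (Sym2 V)} (hα : α ∈ 𝓐) (hβ' : β' ∈ 𝓑)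
    {t t' : ι → Sym2 V} (ht : ∀ j, t j ∈ π j) (ht' : ∀ j, t' j ∈ π j)
    (htg : tg W t = α ∪ β) (htg' : tg W t' = α' ∪ β') :
    (insideSet B t \ insideSet B t').card < r := by
  by_contra hle
  rw [not_lt] at hle
  have outA : ∀ e ∈ α, ¬ ∀ v ∈ e, v ∈ B := fun e he hin => by
    obtain ⟨v, hv, hvB⟩ := h𝓐 α hα e he
    exact hvB (hin v hv)
  have hsub := hybrid_subset_sdiff (W := W) ht ht' (by rw [htg]; exact subset_union_left)
    (by rw [htg']; exact subset_union_right) outA (h𝓑 β' hβ')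
  exact hN α hα β' hβ' ((hD2r _ hle).mono_left (SimpleGraph.fromEdgeSet_mono (Finset.coe_subset.2 hsub)))

/-! ### Counting: patterns in a Hamming ball -/

/-- The Hamming ball: subsets of `I` of size `< 2r − 1`. -/
def ball {ι : Type*} [DecidableEq ι] (I : Finset ι) (r : ℕ) : Finset (Finset ι) :=
  (range (2 * r - 1)).biUnion fun j => I.powersetCard j

/-- Membership in the ball. -/
theorem mem_ball {ι : Type*} [DecidableEq ι] {I D : Finset ι} {r : ℕ} :
    D ∈ ball I r ↔ D ⊆ I ∧ D.card < 2 * r - 1 := by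
  simp only [ball, mem_biUnion, mem_range, mem_powersetCard]
  constructor
  · rintro ⟨j, hj, hDI, hcard⟩
    exact ⟨hDI, by omega⟩
  · rintro ⟨hDI, hcard⟩
    exact ⟨D.card, hcard, hDI, rfl⟩

/-- `|ball I r| ≤ ∑_{j < 2r−1} C(|I|, j)`. -/
theorem card_ball_le {ι : Type*} [DecidableEq ι] (I : Finset ι) (r : ℕ) :
    (ball I r).card ≤ ∑ j ∈ range (2 * r - 1), I.card.choose j := by
  refine card_biUnion_le.trans (le_of_eq (sum_congr rfl fun j _ => ?_))
  exact card_powersetCard _ _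

/-- The transversals whose inside-pattern on `I`, compared with `t₀`'s, is flipped exactly on `D` (free outside `I`). -/
def patternClass {V ι : Type*} [Fintype V] [DecidableEq V] [Fintype ι] [DecidableEq ι] (π : ι → Finset (Sym2 V))
    (B : Finset V) (I : Finset ι) (t₀ : ι → Sym2 V) (D : Finset ι) : Finset (ι → Sym2 V) :=
  Fintype.piFinset fun i =>
    if i ∈ I then (π i).filter fun e => ((∀ v ∈ e, v ∈ B) ↔ ((∀ v ∈ t₀ i, v ∈ B) ↔ i ∉ D)) else π i

/-- A pattern class has at most `(∏_{i ∈ I} max(aᵢ,bᵢ)) · ∏_{i ∉ I} |πᵢ|` transversals. -/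
theorem card_patternClass_le {V ι : Type*} [Fintype V] [DecidableEq V] [Fintype ι] [DecidableEq ι] (π : ι → Finset (Sym2 V))
    (B : Finset V) (I : Finset ι) (t₀ : ι → Sym2 V) (D : Finset ι) :
    (patternClass π B I t₀ D).card ≤
      (∏ i ∈ I, max (((π i).filter fun e => ∀ v ∈ e, v ∈ B).card) (((π i).filter fun e => ¬ ∀ v ∈ e, v ∈ B).card))
        * ∏ i ∈ univ \ I, (π i).card := by
  have key : ∀ i,
      (if i ∈ I then (π i).filter fun e => ((∀ v ∈ e, v ∈ B) ↔ ((∀ v ∈ t₀ i, v ∈ B) ↔ i ∉ D)) else π i).card ≤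
        if i ∈ I then max (((π i).filter fun e => ∀ v ∈ e, v ∈ B).card)
          (((π i).filter fun e => ¬ ∀ v ∈ e, v ∈ B).card) else (π i).card := by
    intro i
    split_ifs with hi
    · by_cases hP : ((∀ v ∈ t₀ i, v ∈ B) ↔ i ∉ D)
      · refine le_trans (card_le_card fun e he => ?_) (le_max_left _ _)
        rw [mem_filter] at he ⊢
        exact ⟨he.1, he.2.2 hP⟩
      · refine le_trans (card_le_card fun e he => ?_) (le_max_right _ _)
        rw [mem_filter] at he ⊢
        exact ⟨he.1, fun h => hP (he.2.1 h)⟩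
    · exact le_rfl
  unfold patternClass
  rw [Fintype.card_piFinset]
  refine (prod_le_prod (fun i _ => Nat.zero_le _) fun i _ => key i).trans (le_of_eq ?_)
  rw [prod_ite, filter_mem_eq_inter, univ_inter, filter_not, filter_mem_eq_inter, univ_inter]

/-- **Robust count.**  Under `D2ᵣ`, for every cut `B`, every cut rectangle `𝓐 ⊗ 𝓑` over `B` inside NON-3-COL and every
unit set `I`, at most `(∑_{j<2r−1} C(|I|,j)) · (∏_{i∈I} max(aᵢ,bᵢ)) · ∏_{i∉I} |πᵢ|` transversals land in the rectangle:
their inside-patterns on `I` lie in a Hamming ball of radius `2r − 2`.  (`r = 1`: one pattern, the landed count.) -/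
theorem card_rect_transversals_le_ball {V ι : Type*} [Fintype V] [DecidableEq V] [Fintype ι] [DecidableEq ι]
    {W : Finset (Sym2 V)} {π : ι → Finset (Sym2 V)} {r : ℕ} (hD2r : RobustD2 W π r) {B : Finset V}
    {𝓐 𝓑 : Finset (Finset (Sym2 V))}
    (h𝓐 : ∀ α ∈ 𝓐, ∀ e ∈ α, ∃ v ∈ e, v ∉ B) (h𝓑 : ∀ β ∈ 𝓑, ∀ e ∈ β, ∀ v ∈ e, v ∈ B)
    (hN : ∀ α ∈ 𝓐, ∀ β ∈ 𝓑, ¬ (SimpleGraph.fromEdgeSet ((α ∪ β : Finset (Sym2 V)) : Set (Sym2 V))).Colorable 3)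
    (I : Finset ι) :
    (((𝓐 ×ˢ 𝓑) ×ˢ transversals π).filter fun x => tg W x.2 = x.1.1 ∪ x.1.2).card
      ≤ (∑ j ∈ range (2 * r - 1), I.card.choose j) *
        ((∏ i ∈ I, max (((π i).filter fun e => ∀ v ∈ e, v ∈ B).card)
            (((π i).filter fun e => ¬ ∀ v ∈ e, v ∈ B).card)) * ∏ i ∈ univ \ I, (π i).card) := by
  set H := ((𝓐 ×ˢ 𝓑) ×ˢ transversals π).filter fun x => tg W x.2 = x.1.1 ∪ x.1.2 with hH
  have memH : ∀ x, x ∈ H ↔ ((x.1.1 ∈ 𝓐 ∧ x.1.2 ∈ 𝓑) ∧ ∀ i, x.2 i ∈ π i) ∧ tg W x.2 = x.1.1 ∪ x.1.2 := by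
    intro x
    simp only [hH, mem_filter, mem_product, mem_transversals]
  rcases H.eq_empty_or_nonempty with h0 | ⟨x₀, hx₀⟩
  · rw [h0, card_empty]
    exact Nat.zero_le _
  · rw [memH] at hx₀
    -- the projection to the transversal is injective on H
    have hinj : Set.InjOn (fun x : (Finset (Sym2 V) × Finset (Sym2 V)) × (ι → Sym2 V) => x.2) ↑H := by
      rintro ⟨⟨α, β⟩, t⟩ hx ⟨⟨α', β'⟩, t'⟩ hx' htt
      rw [Finset.mem_coe, memH] at hx hx'
      simp only at htt hx hx'
      subst htt
      obtain ⟨rfl, rfl⟩ := parts_unique (B := B) (hx.2.symm.trans hx'.2) (h𝓐 α hx.1.1.1) (h𝓐 α' hx'.1.1.1)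
        (h𝓑 β hx.1.1.2) (h𝓑 β' hx'.1.1.2)
      rfl
    rw [← card_image_of_injOn hinj]
    -- its image lies in the union of the pattern classes of the ball around x₀'s pattern
    have hsub : H.image (fun x => x.2) ⊆ (ball I r).biUnion (patternClass π B I x₀.2) := by
      intro t ht
      rw [mem_image] at ht
      obtain ⟨x, hx, rfl⟩ := ht
      rw [memH] at hx
      rw [mem_biUnion]
      refine ⟨I.filter fun i => ¬ ((∀ v ∈ x.2 i, v ∈ B) ↔ ∀ v ∈ x₀.2 i, v ∈ B), ?_, ?_⟩
      · rw [mem_ball]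
        refine ⟨filter_subset _ _, ?_⟩
        have h1 := card_sdiff_insideSet_lt hD2r h𝓐 h𝓑 hN hx.1.1.1 hx₀.1.1.2 hx.1.2 hx₀.1.2 hx.2 hx₀.2
        have h2 := card_sdiff_insideSet_lt hD2r h𝓐 h𝓑 hN hx₀.1.1.1 hx.1.1.2 hx₀.1.2 hx.1.2 hx₀.2 hx.2
        have h3 : (I.filter fun i => ¬ ((∀ v ∈ x.2 i, v ∈ B) ↔ ∀ v ∈ x₀.2 i, v ∈ B)) ⊆
            (insideSet B x.2 \ insideSet B x₀.2) ∪ (insideSet B x₀.2 \ insideSet B x.2) := by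
          intro i hi
          rw [mem_filter] at hi
          simp only [mem_union, mem_sdiff, mem_insideSet]
          tauto
        have h4 := (card_le_card h3).trans (card_union_le _ _)
        omega
      · unfold patternClass
        rw [Fintype.mem_piFinset]
        intro i
        split_ifs with hiI
        · rw [mem_filter]
          refine ⟨hx.1.2 i, ?_⟩
          simp only [mem_filter, not_and, not_not]
          tauto
        · exact hx.1.2 i
    refine (card_le_card hsub).trans (card_biUnion_le.trans ?_)
    calc ∑ D ∈ ball I r, (patternClass π B I x₀.2 D).card
        ≤ ∑ D ∈ ball I r, ((∏ i ∈ I, max (((π i).filter fun e => ∀ v ∈ e, v ∈ B).card)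
            (((π i).filter fun e => ¬ ∀ v ∈ e, v ∈ B).card)) * ∏ i ∈ univ \ I, (π i).card) :=
          sum_le_sum fun D _ => card_patternClass_le π B I x₀.2 D
      _ ≤ _ := by
          rw [sum_const, smul_eq_mul]
          exact Nat.mul_le_mul_right _ (card_ball_le I r)

/-! ### The robust rectangle mass bounds -/

/-- **Robust transversal engine** (general form): under `D2ᵣ`, the `mu`-mass of a cut rectangle over `B` inside
NON-3-COL is at most `(∑_{j<2r−1} C(|I|,j)) · (∏_{i∈I} max(aᵢ,bᵢ)) · (∏_{i∉I} |πᵢ|) / ∏ᵢ |πᵢ|`, for every unit set `I`. -/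
theorem rect_mass_le_robust {V ι : Type*} [Fintype V] [DecidableEq V] [Fintype ι] [DecidableEq ι]
    {W : Finset (Sym2 V)} {π : ι → Finset (Sym2 V)} {r : ℕ} (hD2r : RobustD2 W π r) {B : Finset V}
    (𝓐 𝓑 : Finset (Finset (Sym2 V)))
    (h𝓐 : ∀ α ∈ 𝓐, ∀ e ∈ α, ¬ e.IsDiag ∧ ∃ v ∈ e, v ∉ B)
    (h𝓑 : ∀ β ∈ 𝓑, ∀ e ∈ β, ¬ e.IsDiag ∧ ∀ v ∈ e, v ∈ B)
    (hN : ∀ α ∈ 𝓐, ∀ β ∈ 𝓑, ¬ (SimpleGraph.fromEdgeSet ((α ∪ β : Finset (Sym2 V)) : Set (Sym2 V))).Colorable 3)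
    (I : Finset ι) :
    ∑ q ∈ 𝓐 ×ˢ 𝓑, mu W π (q.1 ∪ q.2) ≤
      (((∑ j ∈ range (2 * r - 1), I.card.choose j) *
        ((∏ i ∈ I, max (((π i).filter fun e => ∀ v ∈ e, v ∈ B).card)
            (((π i).filter fun e => ¬ ∀ v ∈ e, v ∈ B).card)) * ∏ i ∈ univ \ I, (π i).card) : ℕ) : ℝ)
        / (transversals π).card := by
  set H := ((𝓐 ×ˢ 𝓑) ×ˢ transversals π).filter fun x => tg W x.2 = x.1.1 ∪ x.1.2 with hH
  have hHle := card_rect_transversals_le_ball hD2r (fun α hα e he => (h𝓐 α hα e he).2)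
    (fun β hβ e he => (h𝓑 β hβ e he).2) hN I
  have hcount : H.card = ∑ q ∈ 𝓐 ×ˢ 𝓑, ((transversals π).filter fun t => tg W t = q.1 ∪ q.2).card := by
    have h1 : ∀ q : Finset (Sym2 V) × Finset (Sym2 V),
        ((transversals π).filter fun t => tg W t = q.1 ∪ q.2).card
          = ∑ t ∈ transversals π, if tg W t = q.1 ∪ q.2 then 1 else 0 := fun q => card_filter _ _
    simp only [h1]
    rw [hH, card_filter]
    exact sum_product _ _ _
  have hsum : ∑ q ∈ 𝓐 ×ˢ 𝓑, mu W π (q.1 ∪ q.2) = (H.card : ℝ) / (transversals π).card := by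
    simp only [mu]
    rw [← sum_div, hcount, Nat.cast_sum]
  rw [hsum]
  refine div_le_div_of_nonneg_right ?_ (Nat.cast_nonneg _)
  rw [hH]
  exact_mod_cast hHle

/-- **Split units and the Hamming ball**: with 2-edge units, under `D2ᵣ`, a cut rectangle over `B` inside NON-3-COL has
`mu`-mass at most `(∑_{j<2r−1} C(|I|,j)) / 2^{|I|}` for any set `I` of units SPLIT by `B`.  For `r = 1` this is the
landed `(1/2)^{|I|}`; for `2r − 2 = ρ·|I|` it is `≤ 2^{−(1 − H(ρ))·|I|}` (binary entropy; memo §2). -/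
theorem rect_mass_le_ball {V ι : Type*} [Fintype V] [DecidableEq V] [Fintype ι] [DecidableEq ι]
    {W : Finset (Sym2 V)} {π : ι → Finset (Sym2 V)} (h2 : ∀ i, (π i).card = 2) {r : ℕ}
    (hD2r : RobustD2 W π r) {B : Finset V}
    (I : Finset ι) (hI : ∀ i ∈ I, (∃ e ∈ π i, ∀ v ∈ e, v ∈ B) ∧ (∃ e ∈ π i, ∃ v ∈ e, v ∉ B))
    (𝓐 𝓑 : Finset (Finset (Sym2 V)))
    (h𝓐 : ∀ α ∈ 𝓐, ∀ e ∈ α, ¬ e.IsDiag ∧ ∃ v ∈ e, v ∉ B)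
    (h𝓑 : ∀ β ∈ 𝓑, ∀ e ∈ β, ¬ e.IsDiag ∧ ∀ v ∈ e, v ∈ B)
    (hN : ∀ α ∈ 𝓐, ∀ β ∈ 𝓑, ¬ (SimpleGraph.fromEdgeSet ((α ∪ β : Finset (Sym2 V)) : Set (Sym2 V))).Colorable 3) :
    ∑ q ∈ 𝓐 ×ˢ 𝓑, mu W π (q.1 ∪ q.2) ≤
      ((∑ j ∈ range (2 * r - 1), I.card.choose j : ℕ) : ℝ) / 2 ^ I.card := by
  refine (rect_mass_le_robust hD2r 𝓐 𝓑 h𝓐 h𝓑 hN I).trans ?_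
  -- split units: max(aᵢ, bᵢ) = 1
  have hmax1 : ∀ i ∈ I, max (((π i).filter fun e => ∀ v ∈ e, v ∈ B).card)
      (((π i).filter fun e => ¬ ∀ v ∈ e, v ∈ B).card) ≤ 1 := fun i hi => by
    obtain ⟨⟨e, he, hein⟩, ⟨e', he', v, hv, hvB⟩⟩ := hI i hi
    have ha1 : 1 ≤ ((π i).filter fun e => ∀ v ∈ e, v ∈ B).card := card_pos.2 ⟨e, mem_filter.2 ⟨he, hein⟩⟩
    have hb1 : 1 ≤ ((π i).filter fun e => ¬ ∀ v ∈ e, v ∈ B).card :=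
      card_pos.2 ⟨e', mem_filter.2 ⟨he', fun h => hvB (h v hv)⟩⟩
    have hab : ((π i).filter fun e => ∀ v ∈ e, v ∈ B).card +
        ((π i).filter fun e => ¬ ∀ v ∈ e, v ∈ B).card = 2 := by
      rw [card_filter_add_card_filter_not, h2 i]
    omega
  have hprodI : ∏ i ∈ I, max (((π i).filter fun e => ∀ v ∈ e, v ∈ B).card)
      (((π i).filter fun e => ¬ ∀ v ∈ e, v ∈ B).card) ≤ 1 := by
    calc _ ≤ ∏ i ∈ I, (1 : ℕ) := prod_le_prod (fun i _ => Nat.zero_le _) hmax1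
      _ = 1 := prod_const_one
  have hout : ∏ i ∈ univ \ I, (π i).card = 2 ^ (Fintype.card ι - I.card) := by
    rw [prod_congr rfl fun i _ => h2 i, prod_const, card_univ_sdiff]
  have hT : ((transversals π).card : ℝ) = 2 ^ Fintype.card ι := by
    rw [card_transversals]
    simp only [h2, prod_const, card_univ]
    push_cast
    rfl
  have hIle : I.card ≤ Fintype.card ι := card_le_univ I
  have hnum : (∑ j ∈ range (2 * r - 1), I.card.choose j) *
      ((∏ i ∈ I, max (((π i).filter fun e => ∀ v ∈ e, v ∈ B).card)
          (((π i).filter fun e => ¬ ∀ v ∈ e, v ∈ B).card)) * ∏ i ∈ univ \ I, (π i).card)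
        ≤ (∑ j ∈ range (2 * r - 1), I.card.choose j) * 2 ^ (Fintype.card ι - I.card) := by
    refine Nat.mul_le_mul_left _ ?_
    calc _ ≤ 1 * ∏ i ∈ univ \ I, (π i).card := Nat.mul_le_mul_right _ hprodI
      _ = 2 ^ (Fintype.card ι - I.card) := by rw [one_mul, hout]
  rw [hT]
  calc _ ≤ ((∑ j ∈ range (2 * r - 1), I.card.choose j : ℕ) : ℝ) * (2 : ℝ) ^ (Fintype.card ι - I.card)
        / 2 ^ Fintype.card ι := by
        gcongr
        exact_mod_cast hnum
    _ = ((∑ j ∈ range (2 * r - 1), I.card.choose j : ℕ) : ℝ) / 2 ^ I.card := by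
        rw [pow_sub₀ (2 : ℝ) two_ne_zero hIle]
        have h2a : (2 : ℝ) ^ Fintype.card ι ≠ 0 := pow_ne_zero _ two_ne_zero
        have h2b : (2 : ℝ) ^ I.card ≠ 0 := pow_ne_zero _ two_ne_zero
        field_simp

/-! ### The robust spread reduction -/

/-- The hypothesis of the LANDED exact spread reduction `AeaCutRectanglesFixedCutFooling.foolingMeasure_of_spreadSystem`,
verbatim. -/
def ExactSpreadHypothesis : Prop :=
  ∃ ε : ℝ, 0 < ε ∧ ε ≤ 1 / 4 ∧ ∀ C : ℕ, ∃ᶠ n in Filter.atTop,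
    ∃ (m : ℕ) (W : Finset (Sym2 (Fin n))) (π : Fin m → Finset (Sym2 (Fin n))),
      (∀ i, (π i).card = 2) ∧
      (∀ t : Fin m → Sym2 (Fin n), (∀ i, t i ∈ π i) →
        (∀ e ∈ tg W t, ¬ e.IsDiag) ∧
          ¬ (SimpleGraph.fromEdgeSet (↑(tg W t) : Set (Sym2 (Fin n)))).Colorable 3) ∧
      (∀ i, (SimpleGraph.fromEdgeSet (↑(gammaMinus W π i) : Set (Sym2 (Fin n)))).Colorable 3) ∧
      ∀ B : Finset (Fin n), (1 / 2 - ε) * (n : ℝ) ≤ B.card → (B.card : ℝ) ≤ (1 / 2 + ε) * n →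
        ∃ I : Finset (Fin m), (n : ℝ) / 2 * Real.logb 2 n + (C : ℝ) * n ≤ I.card ∧
          ∀ i ∈ I, (∃ e ∈ π i, ∀ v ∈ e, v ∈ B) ∧ (∃ e ∈ π i, ∃ v ∈ e, v ∉ B)

/-- The ROBUST spread hypothesis: 2-edge unit systems with D1, `D2ᵣ` for some `r`, and over every near-balanced cut a
split set `I` whose Hamming ball of radius `2r − 2` is small against the demand:
`∑_{j<2r−1} C(|I|,j) ≤ 2^{|I| − ((n/2)·log₂ n + C·n)}`. -/
def RobustSpreadHypothesis : Prop :=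
  ∃ ε : ℝ, 0 < ε ∧ ε ≤ 1 / 4 ∧ ∀ C : ℕ, ∃ᶠ n in Filter.atTop,
    ∃ (m r : ℕ) (W : Finset (Sym2 (Fin n))) (π : Fin m → Finset (Sym2 (Fin n))),
      (∀ i, (π i).card = 2) ∧
      (∀ t : Fin m → Sym2 (Fin n), (∀ i, t i ∈ π i) →
        (∀ e ∈ tg W t, ¬ e.IsDiag) ∧
          ¬ (SimpleGraph.fromEdgeSet (↑(tg W t) : Set (Sym2 (Fin n)))).Colorable 3) ∧
      RobustD2 W π r ∧
      ∀ B : Finset (Fin n), (1 / 2 - ε) * (n : ℝ) ≤ B.card → (B.card : ℝ) ≤ (1 / 2 + ε) * n →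
        ∃ I : Finset (Fin m), (∀ i ∈ I, (∃ e ∈ π i, ∀ v ∈ e, v ∈ B) ∧ (∃ e ∈ π i, ∃ v ∈ e, v ∉ B)) ∧
          ((∑ j ∈ range (2 * r - 1), I.card.choose j : ℕ) : ℝ) ≤
            (2 : ℝ) ^ ((I.card : ℝ) - ((n : ℝ) / 2 * Real.logb 2 n + (C : ℝ) * n))

/-- **ROBUST SPREAD REDUCTION.**  `RobustSpreadHypothesis` implies X1
`Summit.PneNP.PneNP.Theses.AeaCutRectangles.FoolingMeasure` — same `ε`, same `C ↦ n` schedule, measure `mu W π`. -/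
theorem foolingMeasure_of_robustSpreadSystem (h : RobustSpreadHypothesis) :
    Summit.PneNP.PneNP.Theses.AeaCutRectangles.FoolingMeasure := by
  obtain ⟨ε, hε0, hε1, hC⟩ := h
  refine ⟨ε, hε0, hε1, fun C => ?_⟩
  refine (hC C).mono fun n hn => ?_
  obtain ⟨m, r, W, π, h2, hD1, hD2r, hspread⟩ := hn
  refine ⟨mu W π, fun S => mu_nonneg W π S, mu_sum W (fun i => ?_), fun S hS => ?_, ?_⟩
  · rw [← Finset.card_pos, h2 i]
    norm_num
  · obtain ⟨t, ht, rfl⟩ := mu_support hS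
    exact hD1 t ht
  · intro B hB1 hB2 𝓐 𝓑 h𝓐 h𝓑 hN
    obtain ⟨I, hI, hball⟩ := hspread B hB1 hB2
    refine (rect_mass_le_ball h2 hD2r I hI 𝓐 𝓑 h𝓐 h𝓑 hN).trans ?_
    have h2I : (0 : ℝ) < 2 ^ I.card := pow_pos two_pos _
    have hTpos : (0 : ℝ) < (2 : ℝ) ^ ((n : ℝ) / 2 * Real.logb 2 n + (C : ℝ) * n) := Real.rpow_pos_of_pos two_pos _
    calc _ ≤ (2 : ℝ) ^ ((I.card : ℝ) - ((n : ℝ) / 2 * Real.logb 2 n + (C : ℝ) * n)) / 2 ^ I.card :=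
          div_le_div_of_nonneg_right hball h2I.le
      _ = (2 : ℝ) ^ (-((n : ℝ) / 2 * Real.logb 2 n) - (C : ℝ) * n) := by
          rw [show -((n : ℝ) / 2 * Real.logb 2 n) - (C : ℝ) * n = -((n : ℝ) / 2 * Real.logb 2 n + (C : ℝ) * n) by ring,
            Real.rpow_neg (by norm_num : (0 : ℝ) ≤ 2), Real.rpow_sub two_pos, Real.rpow_natCast]
          field_simp

/-- The landed exact hypothesis is the case `r = 1` of the robust one. -/
theorem robustSpread_of_exactSpread (h : ExactSpreadHypothesis) : RobustSpreadHypothesis := by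
  obtain ⟨ε, hε0, hε1, hC⟩ := h
  refine ⟨ε, hε0, hε1, fun C => ?_⟩
  refine (hC C).mono fun n hn => ?_
  obtain ⟨m, W, π, h2, hD1, hD2, hspread⟩ := hn
  refine ⟨m, 1, W, π, h2, hD1, robustD2_one_iff.2 hD2, fun B hB1 hB2 => ?_⟩
  obtain ⟨I, hIcard, hI⟩ := hspread B hB1 hB2
  refine ⟨I, hI, ?_⟩
  have hsum : ((∑ j ∈ range (2 * 1 - 1), I.card.choose j : ℕ) : ℝ) = 1 := by norm_num
  rw [hsum]
  exact Real.one_le_rpow (by norm_num) (by linarith)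

/-- Hence the landed exact reduction, re-derived through the robust engine. -/
theorem foolingMeasure_of_exactSpread (h : ExactSpreadHypothesis) :
    Summit.PneNP.PneNP.Theses.AeaCutRectangles.FoolingMeasure :=
  foolingMeasure_of_robustSpreadSystem (robustSpread_of_exactSpread h)


/-! ### The additive form: robustness `r` costs `(2r − 2)·log₂(|I| + 1)` split units -/

/-- `∑_{j ≤ d} C(s, j) ≤ (s + 1)^d` (folklore; cf. `ConvexRankGatesConvexGateBlindVertices.sum_range_choose_le_pow`). -/
theorem sum_range_choose_le_pow (s d : ℕ) : ∑ j ∈ range (d + 1), s.choose j ≤ (s + 1) ^ d := by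
  induction d with
  | zero => simp
  | succ d ih =>
    rw [sum_range_succ, pow_succ]
    have h1 : s.choose (d + 1) ≤ s * (s + 1) ^ d := by
      calc s.choose (d + 1) ≤ s ^ (d + 1) := Nat.choose_le_pow s (d + 1)
        _ = s * s ^ d := by ring
        _ ≤ s * (s + 1) ^ d := Nat.mul_le_mul_left _ (Nat.pow_le_pow_left (by omega) _)
    calc ∑ j ∈ range (d + 1), s.choose j + s.choose (d + 1)
        ≤ (s + 1) ^ d + s * (s + 1) ^ d := Nat.add_le_add ih h1
      _ = (s + 1) ^ d * (s + 1) := by ring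

/-- The Hamming-ball clause from an ADDITIVE split demand: if `T + (2r−2)·log₂(s+1) ≤ s` then
`∑_{j<2r−1} C(s,j) ≤ 2^{s − T}`. -/
theorem ball_le_two_rpow {s r : ℕ} {T : ℝ}
    (h : T + ((2 * r - 2 : ℕ) : ℝ) * Real.logb 2 ((s : ℝ) + 1) ≤ s) :
    ((∑ j ∈ range (2 * r - 1), s.choose j : ℕ) : ℝ) ≤ (2 : ℝ) ^ ((s : ℝ) - T) := by
  rcases Nat.eq_zero_or_pos r with rfl | hr
  · have h0 : (0 : ℝ) ≤ (2 : ℝ) ^ ((s : ℝ) - T) := (Real.rpow_pos_of_pos two_pos _).le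
    simpa using h0
  · have hd : 2 * r - 1 = (2 * r - 2) + 1 := by omega
    rw [hd]
    have h1 : ((∑ j ∈ range (2 * r - 2 + 1), s.choose j : ℕ) : ℝ) ≤ (((s + 1) ^ (2 * r - 2) : ℕ) : ℝ) := by
      exact_mod_cast sum_range_choose_le_pow s (2 * r - 2)
    refine h1.trans ?_
    have hpos : (0 : ℝ) < (s : ℝ) + 1 := by positivity
    calc (((s + 1) ^ (2 * r - 2) : ℕ) : ℝ) = ((s : ℝ) + 1) ^ (2 * r - 2) := by push_cast; ring
      _ = (2 : ℝ) ^ (Real.logb 2 ((s : ℝ) + 1) * ((2 * r - 2 : ℕ) : ℝ)) := by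
          rw [Real.rpow_mul (by norm_num : (0 : ℝ) ≤ 2), Real.rpow_logb two_pos (by norm_num) hpos,
            Real.rpow_natCast]
      _ ≤ (2 : ℝ) ^ ((s : ℝ) - T) := Real.rpow_le_rpow_of_exponent_le (by norm_num) (by linarith)

/-- **ROBUST SPREAD REDUCTION, additive form.**  2-edge unit systems with D1 and `D2ᵣ` whose every near-balanced cut
splits `≥ (n/2)·log₂ n + C·n + (2r − 2)·log₂(|I| + 1)` units give X1: robustness costs an additive `O(r·log m)` in the
split demand — negligible against `C·n` for every `r = o(n / log n)`. -/
theorem foolingMeasure_of_robustSpreadSystem_additive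
    (h : ∃ ε : ℝ, 0 < ε ∧ ε ≤ 1 / 4 ∧ ∀ C : ℕ, ∃ᶠ n in Filter.atTop,
      ∃ (m r : ℕ) (W : Finset (Sym2 (Fin n))) (π : Fin m → Finset (Sym2 (Fin n))),
        (∀ i, (π i).card = 2) ∧
        (∀ t : Fin m → Sym2 (Fin n), (∀ i, t i ∈ π i) →
          (∀ e ∈ tg W t, ¬ e.IsDiag) ∧
            ¬ (SimpleGraph.fromEdgeSet (↑(tg W t) : Set (Sym2 (Fin n)))).Colorable 3) ∧
        RobustD2 W π r ∧
        ∀ B : Finset (Fin n), (1 / 2 - ε) * (n : ℝ) ≤ B.card → (B.card : ℝ) ≤ (1 / 2 + ε) * n →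
          ∃ I : Finset (Fin m),
            (n : ℝ) / 2 * Real.logb 2 n + (C : ℝ) * n +
                ((2 * r - 2 : ℕ) : ℝ) * Real.logb 2 ((I.card : ℝ) + 1) ≤ I.card ∧
              ∀ i ∈ I, (∃ e ∈ π i, ∀ v ∈ e, v ∈ B) ∧ (∃ e ∈ π i, ∃ v ∈ e, v ∉ B)) :
    Summit.PneNP.PneNP.Theses.AeaCutRectangles.FoolingMeasure := by
  refine foolingMeasure_of_robustSpreadSystem ?_
  obtain ⟨ε, hε0, hε1, hC⟩ := h
  refine ⟨ε, hε0, hε1, fun C => (hC C).mono fun n hn => ?_⟩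
  obtain ⟨m, r, W, π, h2, hD1, hD2r, hspread⟩ := hn
  refine ⟨m, r, W, π, h2, hD1, hD2r, fun B hB1 hB2 => ?_⟩
  obtain ⟨I, hIcard, hI⟩ := hspread B hB1 hB2
  exact ⟨I, hI, ball_le_two_rpow hIcard⟩

/-! ### Robustness has teeth: a D1 system with `D2₂` and NOT D2 (toy, kernel-decided) -/

/-- A graph containing the six edges of a `K₄` is not 3-colourable. -/
theorem not_colorable_of_K4 {V : Type*} [DecidableEq V] {S : Finset (Sym2 V)} (K : Finset V) (hK4 : K.card = 4)
    (hK : ∀ x ∈ K, ∀ y ∈ K, x ≠ y → s(x, y) ∈ S) :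
    ¬ (SimpleGraph.fromEdgeSet (↑S : Set (Sym2 V))).Colorable 3 := by
  intro hcol
  refine hcol.cliqueFree (by norm_num : 3 < 4) K ⟨?_, hK4⟩
  intro x hx y hy hxy
  rw [SimpleGraph.fromEdgeSet_adj]
  exact ⟨hK x (Finset.mem_coe.1 hx) y (Finset.mem_coe.1 hy) hxy, hxy⟩

namespace Toy

/-- Frame on `Fin 10`: apex `9` joined to `0,…,8`; of the triangles `A = {0,1,2}`, `B = {3,4,5}`, `C = {6,7,8}` the frame
keeps `02`, `45, 35`, `78, 68` (so `A` misses `01, 12`, `B` misses `34`, `C` misses `67`). -/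
def Wt : Finset (Sym2 (Fin 10)) :=
  {s(0, 2), s(4, 5), s(3, 5), s(7, 8), s(6, 8),
    s(9, 0), s(9, 1), s(9, 2), s(9, 3), s(9, 4), s(9, 5), s(9, 6), s(9, 7), s(9, 8)}

/-- Two disjoint, distinct 2-edge units: `π₀ = {01, 34}`, `π₁ = {12, 67}`. -/
def Ut : Fin 2 → Finset (Sym2 (Fin 10)) := ![{s(0, 1), s(3, 4)}, {s(1, 2), s(6, 7)}]

theorem Ut_zero : Ut 0 = {s(0, 1), s(3, 4)} := rfl
theorem Ut_one : Ut 1 = {s(1, 2), s(6, 7)} := rfl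

theorem units_card : ∀ i, (Ut i).card = 2 := by decide

theorem units_disjoint : Disjoint (Ut 0) (Ut 1) := by decide

theorem mem_tg_toy (t : Fin 2 → Sym2 (Fin 10)) (e : Sym2 (Fin 10)) :
    e ∈ tg Wt t ↔ e ∈ Wt ∨ t 0 = e ∨ t 1 = e := by
  rw [mem_tg, Fin.exists_fin_two]

/-- D1: every transversal graph is loopless and non-3-colourable (each completes a triangle under the apex: a `K₄`). -/
theorem D1_toy : ∀ t : Fin 2 → Sym2 (Fin 10), (∀ i, t i ∈ Ut i) →
    (∀ e ∈ tg Wt t, ¬ e.IsDiag) ∧ ¬ (SimpleGraph.fromEdgeSet (↑(tg Wt t) : Set (Sym2 (Fin 10)))).Colorable 3 := by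
  intro t ht
  have h0 := ht 0
  have h1 := ht 1
  rw [Ut_zero, mem_insert, mem_singleton] at h0
  rw [Ut_one, mem_insert, mem_singleton] at h1
  have hWloop : ∀ e ∈ Wt, ¬ e.IsDiag := by decide
  constructor
  · intro e he
    rw [mem_tg_toy] at he
    rcases he with he | rfl | rfl
    · exact hWloop e he
    · rcases h0 with h | h <;> rw [h] <;> decide
    · rcases h1 with h | h <;> rw [h] <;> decide
  · rcases h0 with h0 | h0 <;> rcases h1 with h1 | h1
    · have key : ∀ x ∈ ({0, 1, 2, 9} : Finset (Fin 10)), ∀ y ∈ ({0, 1, 2, 9} : Finset (Fin 10)), x ≠ y →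
          s(x, y) ∈ Wt ∨ s(0, 1) = s(x, y) ∨ s(1, 2) = s(x, y) := by decide
      exact not_colorable_of_K4 ({0, 1, 2, 9} : Finset (Fin 10)) (by decide) fun x hx y hy hxy => by
        rw [mem_tg_toy, h0, h1]; exact key x hx y hy hxy
    · have key : ∀ x ∈ ({6, 7, 8, 9} : Finset (Fin 10)), ∀ y ∈ ({6, 7, 8, 9} : Finset (Fin 10)), x ≠ y →
          s(x, y) ∈ Wt ∨ s(0, 1) = s(x, y) ∨ s(6, 7) = s(x, y) := by decide
      exact not_colorable_of_K4 ({6, 7, 8, 9} : Finset (Fin 10)) (by decide) fun x hx y hy hxy => by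
        rw [mem_tg_toy, h0, h1]; exact key x hx y hy hxy
    · have key : ∀ x ∈ ({3, 4, 5, 9} : Finset (Fin 10)), ∀ y ∈ ({3, 4, 5, 9} : Finset (Fin 10)), x ≠ y →
          s(x, y) ∈ Wt ∨ s(3, 4) = s(x, y) ∨ s(1, 2) = s(x, y) := by decide
      exact not_colorable_of_K4 ({3, 4, 5, 9} : Finset (Fin 10)) (by decide) fun x hx y hy hxy => by
        rw [mem_tg_toy, h0, h1]; exact key x hx y hy hxy
    · have key : ∀ x ∈ ({3, 4, 5, 9} : Finset (Fin 10)), ∀ y ∈ ({3, 4, 5, 9} : Finset (Fin 10)), x ≠ y →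
          s(x, y) ∈ Wt ∨ s(3, 4) = s(x, y) ∨ s(6, 7) = s(x, y) := by decide
      exact not_colorable_of_K4 ({3, 4, 5, 9} : Finset (Fin 10)) (by decide) fun x hx y hy hxy => by
        rw [mem_tg_toy, h0, h1]; exact key x hx y hy hxy

/-- `D2₂`: removing both units leaves the frame, which is 3-colourable (apex colour `2`, a proper 2-colouring below). -/
theorem robustD2_two_toy : RobustD2 Wt Ut 2 := by
  intro J hJ
  have hJu : J = univ := Finset.eq_univ_of_card J (le_antisymm (card_le_univ J) (by simpa using hJ))
  subst hJu
  have hW : gammaMinusSet Wt Ut univ = Wt := by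
    ext e
    simp [mem_gammaMinusSet]
  rw [hW]
  have hvalid : ∀ v w : Fin 10, s(v, w) ∈ Wt → v ≠ w →
      (![0, 0, 1, 1, 1, 0, 1, 1, 0, 2] v : Fin 3) ≠ ![0, 0, 1, 1, 1, 0, 1, 1, 0, 2] w := by decide
  exact ⟨SimpleGraph.Coloring.mk (![0, 0, 1, 1, 1, 0, 1, 1, 0, 2] : Fin 10 → Fin 3) fun {v w} hvw => by
    rw [SimpleGraph.fromEdgeSet_adj] at hvw
    exact hvalid v w (Finset.mem_coe.1 hvw.1) hvw.2⟩

/-- NOT D2: removing unit `0` alone keeps `67 ∈ π₁`, which completes triangle `C` under the apex. -/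
theorem not_robustD2_one_toy : ¬ RobustD2 Wt Ut 1 := by
  intro h
  have h1 := h {0} (by simp)
  have key : ∀ x ∈ ({6, 7, 8, 9} : Finset (Fin 10)), ∀ y ∈ ({6, 7, 8, 9} : Finset (Fin 10)), x ≠ y →
      s(x, y) ∈ Wt ∨ s(x, y) ∈ ({s(1, 2), s(6, 7)} : Finset (Sym2 (Fin 10))) := by decide
  refine not_colorable_of_K4 ({6, 7, 8, 9} : Finset (Fin 10)) (by decide) (fun x hx y hy hxy => ?_) h1
  rw [mem_gammaMinusSet]
  rcases key x hx y hy hxy with h' | h'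
  · exact Or.inl h'
  · exact Or.inr ⟨1, by simp, by rw [Ut_one]; exact h'⟩

/-- **Robustness has teeth.**  A 2-edge unit system with disjoint units satisfying D1 and `D2₂` but NOT D2: the class of
systems the robust engine accepts is strictly larger than the exact engine's. -/
theorem robust_not_exact :
    (∀ i, (Ut i).card = 2) ∧ Disjoint (Ut 0) (Ut 1) ∧
    (∀ t : Fin 2 → Sym2 (Fin 10), (∀ i, t i ∈ Ut i) →
      (∀ e ∈ tg Wt t, ¬ e.IsDiag) ∧ ¬ (SimpleGraph.fromEdgeSet (↑(tg Wt t) : Set (Sym2 (Fin 10)))).Colorable 3) ∧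
    RobustD2 Wt Ut 2 ∧ ¬ RobustD2 Wt Ut 1 :=
  ⟨units_card, units_disjoint, D1_toy, robustD2_two_toy, not_robustD2_one_toy⟩

end Toy

end Summit.PneNP.PneNP.Cruxes.FoolingMeasure.P4g10
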